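import Mathlib
import Summits.Ventures.HodgeRepro2.T5HaarCosetAverage
import Summits.Ventures.HodgeRepro2.T5CharacterDescent
import Summits.Ventures.HodgeRepro2.T5ShiftCharacter

/-!
# T5KudlaGaussSum — Kudla's Gauss sum as an INTEGRAL, `𝔤(ω) = q^{c/2} ∫_𝒪 ω(y) ψ(ϖ^{-c} y) dy`, and the
identity `𝔤(ω)·𝔤(ω⁻¹) = ω(−1)` with every object in the shape of print

Kernel support for Tier 5, sub-step N5 / §G, reading residual [R-4] («Tate half»; route/T5-CHECK-G-p7.md §4,
§12.2 row P1.10, §16.2). The chain `T5LocalRingGaussSum` → `T5DVRQuotientModel` → `T5ConductorDictionary` →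
`T5CharacterDescent` proves the finite-sum identity `𝔤(χ)·𝔤(χ⁻¹) = χ(−1)` for the character `χ` of `𝒪/𝔭^c` induced
by a character `ω'` of `𝒪^×` of conductor exponent exactly `c`; `T5HaarCosetAverage` identifies Kudla's INTEGRAL
over `𝒪^×` with the finite sum. This file puts the two together and states the result for the objects of print:

* `kudlaGaussSum μ hϖ ω' h Ψ := √|𝒪/𝔭^{m+1}| · ∫_𝒪 ω'(y) Ψ(y ϖ^{-(m+1)}) dμ(y)` — Kudla's `𝔤` for
  `ν = 0` (`Ψ` of conductor `𝒪`), the integrand extended by `0` off `𝒪^×` (`descendChar ω'` vanishes on the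
  non-units), `μ` the additive Haar probability measure of `𝒪` (any left-invariant probability measure);
* `kudlaGaussSum_eq_gNorm`: it IS `gNorm (descendChar ω') (shiftChar …)`, the normalised finite Gauss sum;
* **`kudlaGaussSum_mul_kudlaGaussSum_inv`**: for `ω'` of conductor exponent exactly `m + 1` and `Ψ` of
  conductor exactly `𝒪`, `𝔤(ω')·𝔤(ω'⁻¹) = ω'(−1)` — the Gauss-sum identity of (T1), CHECK-G §4, in the
  form «substitution `y ↦ −y` … `|𝔤| = 1`», with `𝔤` Kudla's integral.

* `kudlaGaussSumZ` / `kudlaGaussSumZ_mul_kudlaGaussSumZ_inv`: the same for `ψ` of arbitrary conductor `𝔭^{-ν}`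
  (shift `ϖ^{-k}`, `k = ν + c`, via `T5ShiftCharacter.shiftCharZ`).

What stays prose is only the reading of print: that Kudla's displayed `𝔤(ω, ψ)` is this integral with `vol(𝒪_v) = 1`,
and that `ω'` is `ω_v^{±1}` restricted to `𝒪_v^×`.
-/

namespace Summit.Ventures.HodgeRepro2.T5KudlaGaussSum

open MeasureTheory
open Summit.Ventures.HodgeRepro2.T5LocalRingGaussSum
open Summit.Ventures.HodgeRepro2.T5DVRQuotientModel
open Summit.Ventures.HodgeRepro2.T5PrincipalUnitFiltration
open Summit.Ventures.HodgeRepro2.T5ConductorArithmetic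
open Summit.Ventures.HodgeRepro2.T5ConductorDictionary
open Summit.Ventures.HodgeRepro2.T5CharacterDescent
open Summit.Ventures.HodgeRepro2.T5HaarCosetAverage
open Summit.Ventures.HodgeRepro2.T5ShiftCharacter

variable {𝒪 : Type*} [CommRing 𝒪] [IsDomain 𝒪] [IsDiscreteValuationRing 𝒪] {ϖ : 𝒪} {m : ℕ}

/-- The quotient map `𝒪 → 𝒪 ⧸ (ϖ^{m+1})`. -/
local notation "π" => Ideal.Quotient.mk (Ideal.span ({ϖ ^ (m + 1)} : Set 𝒪))

/-! ### The inverse character descends to the inverse -/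

section Inverse

/-- `(descendChar ω')⁻¹ = descendChar ω'⁻¹` — the inverse character descends to the inverse. -/
theorem descendChar_inv (hϖ : Irreducible ϖ) (ω' : 𝒪ˣ →* ℂˣ) (h : higherUnits ϖ (m + 1) ≤ ω'.ker)
    (h' : higherUnits ϖ (m + 1) ≤ ω'⁻¹.ker) :
    (descendChar hϖ ω' h)⁻¹ = descendChar hϖ ω'⁻¹ h' := by
  apply MulChar.ext
  intro v
  obtain ⟨u, rfl⟩ := unitsMap_surjective hϖ v
  have hu : ((Units.map (π : 𝒪 →* 𝒪 ⧸ Ideal.span ({ϖ ^ (m + 1)} : Set 𝒪)) u : _ˣ) : _) = π (u : 𝒪) :=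
    rfl
  rw [hu, MulChar.inv_apply_eq_inv, descendChar_mk, descendChar_mk, MonoidHom.inv_apply,
    Units.val_inv_eq_inv_val, Ring.inverse_eq_inv]

omit [IsDomain 𝒪] [IsDiscreteValuationRing 𝒪] in
/-- A character trivial on `U_{m+1}` has inverse trivial on `U_{m+1}`. -/
theorem higherUnits_le_ker_inv {ω' : 𝒪ˣ →* ℂˣ} (h : higherUnits ϖ (m + 1) ≤ ω'.ker) :
    higherUnits ϖ (m + 1) ≤ ω'⁻¹.ker := by
  intro u hu
  rw [MonoidHom.mem_ker, MonoidHom.inv_apply, inv_eq_one]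
  exact h hu

end Inverse

/-! ### Kudla's integral -/

section Integral

variable [MeasurableSpace 𝒪] [MeasurableAdd 𝒪] (μ : Measure 𝒪) [μ.IsAddLeftInvariant]
  [IsProbabilityMeasure μ] [Fintype (𝒪 ⧸ Ideal.span ({ϖ ^ (m + 1)} : Set 𝒪))]
  {K : Type*} [Field K] [Algebra 𝒪 K] [IsFractionRing 𝒪 K]

/-- **Kudla's Gauss sum as an integral** (`ν = 0`): `√|𝒪/𝔭^{m+1}| · ∫_𝒪 ω'(y) Ψ(y ϖ^{-(m+1)}) dμ(y)`, the
integrand being `descendChar ω'` (the character of `𝒪/𝔭^{m+1}` induced by `ω' : 𝒪^× → ℂ^×`, zero off the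
units — so the integral is over `𝒪^×`) times `Ψ(y / ϖ^{m+1})`. -/
noncomputable def kudlaGaussSum (hϖ : Irreducible ϖ) (ω' : 𝒪ˣ →* ℂˣ)
    (h : higherUnits ϖ (m + 1) ≤ ω'.ker) (Ψ : AddChar K ℂ) : ℂ :=
  ((Real.sqrt (Fintype.card (𝒪 ⧸ Ideal.span ({ϖ ^ (m + 1)} : Set 𝒪))) : ℝ) : ℂ)
    * ∫ y, descendChar hϖ ω' h (π y) * Ψ (algebraMap 𝒪 K y / algebraMap 𝒪 K ϖ ^ (m + 1)) ∂μ

/-- Kudla's integral is the normalised finite Gauss sum `gNorm (descendChar ω') (shiftChar …)`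
(`T5HaarCosetAverage.sqrt_card_mul_integral_eq_gNorm`, with `shiftChar_mk`). -/
theorem kudlaGaussSum_eq_gNorm (hI : MeasurableSet (Ideal.span ({ϖ ^ (m + 1)} : Set 𝒪) : Set 𝒪))
    (hϖ : Irreducible ϖ) (ω' : 𝒪ˣ →* ℂˣ) (h : higherUnits ϖ (m + 1) ≤ ω'.ker) (Ψ : AddChar K ℂ)
    (hΨ : ∀ x : 𝒪, Ψ (algebraMap 𝒪 K x) = 1) :
    kudlaGaussSum μ hϖ ω' h Ψ = gNorm (descendChar hϖ ω' h) (shiftChar m hϖ Ψ hΨ) := by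
  rw [← sqrt_card_mul_integral_eq_gNorm μ _ hI, kudlaGaussSum]
  simp only [shiftChar_mk]

/-- **The Gauss-sum identity of (T1) with Kudla's integral.** For `ω' : 𝒪^× → ℂ^×` of conductor exponent
exactly `m + 1` and `Ψ` an additive character of the fraction field of conductor exactly `𝒪` (trivial on `𝒪`,
non-trivial on `ϖ^{-1}𝒪`), `𝔤(ω')·𝔤(ω'⁻¹) = ω'(−1)` with `𝔤 = kudlaGaussSum`. -/
theorem kudlaGaussSum_mul_kudlaGaussSum_inv
    (hI : MeasurableSet (Ideal.span ({ϖ ^ (m + 1)} : Set 𝒪) : Set 𝒪)) (hϖ : Irreducible ϖ)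
    {ω' : 𝒪ˣ →* ℂˣ} (hex : ∃ n, higherUnits ϖ n ≤ ω'.ker) (hω : conductor (higherUnits ϖ) ω' = m + 1)
    (Ψ : AddChar K ℂ) (hΨ : ∀ x : 𝒪, Ψ (algebraMap 𝒪 K x) = 1) {y : 𝒪}
    (hy : Ψ (algebraMap 𝒪 K y / algebraMap 𝒪 K ϖ) ≠ 1) :
    kudlaGaussSum μ hϖ ω' (higherUnits_le_ker_of_conductor_eq hex hω) Ψ
        * kudlaGaussSum μ hϖ ω'⁻¹ (higherUnits_le_ker_inv (higherUnits_le_ker_of_conductor_eq hex hω)) Ψ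
      = ((ω' (-1) : ℂˣ) : ℂ) := by
  rw [kudlaGaussSum_eq_gNorm μ hI hϖ ω' (higherUnits_le_ker_of_conductor_eq hex hω) Ψ hΨ,
    kudlaGaussSum_eq_gNorm μ hI hϖ ω'⁻¹
      (higherUnits_le_ker_inv (higherUnits_le_ker_of_conductor_eq hex hω)) Ψ hΨ,
    ← descendChar_inv hϖ ω' (higherUnits_le_ker_of_conductor_eq hex hω)
      (higherUnits_le_ker_inv (higherUnits_le_ker_of_conductor_eq hex hω))]
  exact gNorm_mul_gNorm_inv_descendChar hϖ hex hω Ψ hΨ hy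

/-! #### Arbitrary conductor of `ψ`: the shift `ϖ^{-k}`, `k = ν + c` -/

/-- **Kudla's Gauss sum as an integral, arbitrary conductor of `ψ`**: `√|𝒪/𝔭^{m+1}| · ∫_𝒪 ω'(y) Ψ(y ϖ^{-k}) dμ(y)`
(`k ∈ ℤ`; Kudla's `k = ν + c` for `ψ` of conductor `𝔭^{-ν}`, `c = m + 1`). -/
noncomputable def kudlaGaussSumZ (hϖ : Irreducible ϖ) (ω' : 𝒪ˣ →* ℂˣ)
    (h : higherUnits ϖ (m + 1) ≤ ω'.ker) (Ψ : AddChar K ℂ) (k : ℤ) : ℂ :=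
  ((Real.sqrt (Fintype.card (𝒪 ⧸ Ideal.span ({ϖ ^ (m + 1)} : Set 𝒪))) : ℝ) : ℂ)
    * ∫ y, descendChar hϖ ω' h (π y) * Ψ (algebraMap 𝒪 K y * algebraMap 𝒪 K ϖ ^ (-k)) ∂μ

/-- For `Ψ` trivial on `ϖ^{m+1-k}𝒪` the integral is the normalised finite Gauss sum against
`shiftCharZ`. -/
theorem kudlaGaussSumZ_eq_gNorm (hI : MeasurableSet (Ideal.span ({ϖ ^ (m + 1)} : Set 𝒪) : Set 𝒪))
    (hϖ : Irreducible ϖ) (ω' : 𝒪ˣ →* ℂˣ) (h : higherUnits ϖ (m + 1) ≤ ω'.ker) (Ψ : AddChar K ℂ)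
    (k : ℤ) (hΨ : ∀ x : 𝒪, Ψ (algebraMap 𝒪 K x * algebraMap 𝒪 K ϖ ^ ((m + 1 : ℕ) - k)) = 1) :
    kudlaGaussSumZ μ hϖ ω' h Ψ k = gNorm (descendChar hϖ ω' h) (shiftCharZ m hϖ Ψ k hΨ) := by
  rw [← sqrt_card_mul_integral_eq_gNorm μ _ hI, kudlaGaussSumZ]
  simp only [shiftCharZ_mk]

/-- **The Gauss-sum identity of (T1) with Kudla's integral, arbitrary conductor of `ψ`.** For `ω'` of
conductor exponent exactly `m + 1` and `Ψ` trivial on `ϖ^{m+1-k}𝒪` but not on `ϖ^{m-k}𝒪` (conductor exactly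
`ϖ^{m+1-k}𝒪`), `𝔤(ω')·𝔤(ω'⁻¹) = ω'(−1)`. -/
theorem kudlaGaussSumZ_mul_kudlaGaussSumZ_inv
    (hI : MeasurableSet (Ideal.span ({ϖ ^ (m + 1)} : Set 𝒪) : Set 𝒪)) (hϖ : Irreducible ϖ)
    {ω' : 𝒪ˣ →* ℂˣ} (hex : ∃ n, higherUnits ϖ n ≤ ω'.ker) (hω : conductor (higherUnits ϖ) ω' = m + 1)
    (Ψ : AddChar K ℂ) (k : ℤ)
    (hΨ : ∀ x : 𝒪, Ψ (algebraMap 𝒪 K x * algebraMap 𝒪 K ϖ ^ ((m + 1 : ℕ) - k)) = 1) {y : 𝒪}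
    (hy : Ψ (algebraMap 𝒪 K y * algebraMap 𝒪 K ϖ ^ ((m : ℕ) - k)) ≠ 1) :
    kudlaGaussSumZ μ hϖ ω' (higherUnits_le_ker_of_conductor_eq hex hω) Ψ k
        * kudlaGaussSumZ μ hϖ ω'⁻¹ (higherUnits_le_ker_inv (higherUnits_le_ker_of_conductor_eq hex hω)) Ψ k
      = ((ω' (-1) : ℂˣ) : ℂ) := by
  haveI := isLocalRing_quot (m := m) hϖ
  rw [kudlaGaussSumZ_eq_gNorm μ hI hϖ ω' (higherUnits_le_ker_of_conductor_eq hex hω) Ψ k hΨ,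
    kudlaGaussSumZ_eq_gNorm μ hI hϖ ω'⁻¹
      (higherUnits_le_ker_inv (higherUnits_le_ker_of_conductor_eq hex hω)) Ψ k hΨ,
    ← descendChar_inv hϖ ω' (higherUnits_le_ker_of_conductor_eq hex hω)
      (higherUnits_le_ker_inv (higherUnits_le_ker_of_conductor_eq hex hω)),
    gNorm_mul_gNorm_inv ((conductor_eq_iff_isPrimitiveChar_descendChar hϖ ω'
      (higherUnits_le_ker_of_conductor_eq hex hω)).1 hω)
      ((isPrimitive_shiftCharZ_iff hϖ Ψ k hΨ).2 ⟨y, hy⟩)]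
  have : (-1 : 𝒪 ⧸ Ideal.span ({ϖ ^ (m + 1)} : Set 𝒪)) = π ((-1 : 𝒪ˣ) : 𝒪) := by
    rw [Units.coe_neg_one, map_neg, map_one]
  rw [this, descendChar_mk]

end Integral

end Summit.Ventures.HodgeRepro2.T5KudlaGaussSum
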